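import Literature.MathematicalPhysics.QuantumFieldTheory.BalabanRegulatorChart
import HarnessLib

/-!
# Crux `BalabanStepParabolic`, line `perfect-action-regulator-chart`: the Lipschitz bridge

Support file for item stmt-QuantumFields-9684 (route `ParabolicTrajectory` of `YangMills`), registered
stub `stub_parabolicBlock`: a smooth half-chart normal form
`SmoothHalfChart E φ Ψ A φg φy Ψg Ψy b C δ R θ'` (separate partial derivatives of the coupling map
`φ` and the fibre map `Ψ` within `[0, δ]` in `g` and within closed balls in `y`, parabolic derivative
bounds, normalisations `φ 0 y = 0`, `Ψ 0 0 = 0`; vocabulary of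
`Literature/MathematicalPhysics/QuantumFieldTheory/BalabanRegulatorChart.lean`) yields the verbatim
Lipschitz hypothesis block `ParabolicBlock` of `BalabanBanachStep` on the two-sided chart `|g| ≤ δ`,
`‖y‖ ≤ δ` and the basin clauses `BasinBlock` on `‖y‖ ≤ R`, for the odd/even extension
`φ' g y = -φ (-g) y`, `Ψ' g y = Ψ |g| y` (`g < 0`) and the constant `C' = 2C + 1`.

Pure Banach calculus: every estimate is a one-variable mean value inequality
(`Convex.norm_image_sub_le_of_norm_hasDerivWithin_le` on sub-intervals `[[s, t]] ⊆ [0, δ]`,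
`Convex.norm_image_sub_le_of_norm_hasFDerivWithin_le(')` on closed balls), integrated from the
normalisations; the passage to negative couplings is the elementary bookkeeping
`|h(g)| + |h(|g'|)| ≤ C m² (m + ‖y‖) (|g| + |g'|)`, `m = max |g| |g'|`, across `g' < 0 ≤ g`.
No definitions are introduced.
-/

noncomputable section

open Set Metric
open Literature.MathematicalPhysics.QuantumFieldTheory

namespace Summit.QuantumFields.YangMills.Theorems.BalabanStepParabolic

section HalfChart

variable {E : Type} [NormedAddCommGroup E] [NormedSpace ℝ E]
  {φ : ℝ → E → ℝ} {Ψ : ℝ → E → E} {A : E →L[ℝ] E}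
  {φg : ℝ → E → ℝ} {φy : ℝ → E → (E →L[ℝ] ℝ)} {Ψg : ℝ → E → E} {Ψy : ℝ → E → (E →L[ℝ] E)}
  {b C δ R θ' : ℝ}

/-- Derivative of the cubic normal form `t ↦ t + b t³`. -/
private theorem hasDerivAt_cubic (b t : ℝ) :
    HasDerivAt (fun x : ℝ => x + b * x ^ 3) (1 + 3 * b * t ^ 2) t := by
  refine ((hasDerivAt_id' t).add ((hasDerivAt_pow 3 t).const_mul b)).congr_deriv ?_
  push_cast
  ring

/-- Mean value inequality in the coupling for `h(t) = φ t y − (t + b t³)` on `[[s, t]] ⊆ [0, δ]`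
(basin ball `‖y‖ ≤ R`). -/
private theorem phi_base (hS : SmoothHalfChart E φ Ψ A φg φy Ψg Ψy b C δ R θ') {s t : ℝ}
    (hs : s ∈ Icc (0 : ℝ) δ) (ht : t ∈ Icc (0 : ℝ) δ) {y : E} (hy : ‖y‖ ≤ R) :
    |φ t y - (t + b * t ^ 3) - (φ s y - (s + b * s ^ 3))| ≤
      C * (max t s) ^ 2 * (max t s + ‖y‖) * |t - s| := by
  have hsub : uIcc s t ⊆ Icc 0 δ := uIcc_subset_Icc hs ht
  have key := Convex.norm_image_sub_le_of_norm_hasDerivWithin_le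
    (f := fun x : ℝ => φ x y - (x + b * x ^ 3)) (f' := fun x => φg x y - (1 + 3 * b * x ^ 2))
    (s := uIcc s t) (C := C * (max t s) ^ 2 * (max t s + ‖y‖))
    (fun x hx => ((hS.hasDeriv_φ x (hsub hx) y hy).sub
      (hasDerivAt_cubic b x).hasDerivWithinAt).mono hsub)
    (fun x hx => ?_) (convex_uIcc s t) left_mem_uIcc right_mem_uIcc
  · simpa only [Real.norm_eq_abs] using key
  · have hx' : x ∈ Icc (0 : ℝ) δ := hsub hx
    have hx0 : 0 ≤ x := hx'.1
    have hxm : x ≤ max t s :=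
      le_max_iff.2 ((mem_uIcc.1 hx).elim (fun h => Or.inl h.2) fun h => Or.inr h.2)
    have hC := hS.C_nonneg
    rw [Real.norm_eq_abs]
    calc |φg x y - (1 + 3 * b * x ^ 2)| ≤ C * x ^ 2 * (x + ‖y‖) := hS.φg_bound x hx' y hy
      _ ≤ C * (max t s) ^ 2 * (max t s + ‖y‖) := by gcongr

/-- Mean value inequality in the coupling for `t ↦ Ψ t y` on `[[s, t]] ⊆ [0, δ]` (chart ball). -/
private theorem psi_base (hS : SmoothHalfChart E φ Ψ A φg φy Ψg Ψy b C δ R θ') {s t : ℝ}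
    (hs : s ∈ Icc (0 : ℝ) δ) (ht : t ∈ Icc (0 : ℝ) δ) {y : E} (hy : ‖y‖ ≤ δ) :
    ‖Ψ t y - Ψ s y‖ ≤ C * (max t s + ‖y‖) * |t - s| := by
  have hsub : uIcc s t ⊆ Icc 0 δ := uIcc_subset_Icc hs ht
  have key := Convex.norm_image_sub_le_of_norm_hasDerivWithin_le
    (f := fun x : ℝ => Ψ x y) (f' := fun x => Ψg x y) (s := uIcc s t) (C := C * (max t s + ‖y‖))
    (fun x hx => (hS.hasDeriv_Ψ x (hsub hx) y hy).mono hsub)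
    (fun x hx => ?_) (convex_uIcc s t) left_mem_uIcc right_mem_uIcc
  · simpa only [Real.norm_eq_abs] using key
  · have hx' : x ∈ Icc (0 : ℝ) δ := hsub hx
    have hxm : x ≤ max t s :=
      le_max_iff.2 ((mem_uIcc.1 hx).elim (fun h => Or.inl h.2) fun h => Or.inr h.2)
    have hC := hS.C_nonneg
    calc ‖Ψg x y‖ ≤ C * (x + ‖y‖) := hS.Ψg_bound x hx' y hy
      _ ≤ C * (max t s + ‖y‖) := by gcongr

/-- Fibre mean value inequality for `φ t` on the chart ball. -/
private theorem phi_fibre (hS : SmoothHalfChart E φ Ψ A φg φy Ψg Ψy b C δ R θ') {t : ℝ}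
    (ht : t ∈ Icc (0 : ℝ) δ) {y y' : E} (hy : ‖y‖ ≤ δ) (hy' : ‖y'‖ ≤ δ) :
    |φ t y - φ t y'| ≤ C * t ^ 3 * ‖y - y'‖ := by
  have key := Convex.norm_image_sub_le_of_norm_hasFDerivWithin_le
    (f := φ t) (f' := φy t) (s := closedBall (0 : E) δ) (C := C * t ^ 3)
    (fun x hx => hS.hasFDeriv_φ t ht x (mem_closedBall_zero_iff.1 hx))
    (fun x hx => hS.φy_bound t ht x (mem_closedBall_zero_iff.1 hx))
    (convex_closedBall 0 δ) (mem_closedBall_zero_iff.2 hy') (mem_closedBall_zero_iff.2 hy)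
  simpa only [Real.norm_eq_abs] using key

/-- Fibre mean value inequality for `u ↦ Ψ t u − A u` on the ball of radius `ρ ≤ δ`. -/
private theorem psi_fibre (hS : SmoothHalfChart E φ Ψ A φg φy Ψg Ψy b C δ R θ') {t : ℝ}
    (ht : t ∈ Icc (0 : ℝ) δ) {ρ : ℝ} (hρ : ρ ≤ δ) {y y' : E} (hy : ‖y‖ ≤ ρ) (hy' : ‖y'‖ ≤ ρ) :
    ‖Ψ t y - Ψ t y' - A (y - y')‖ ≤ C * (t + ρ) * ‖y - y'‖ := by
  have hsub : closedBall (0 : E) ρ ⊆ closedBall 0 R :=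
    closedBall_subset_closedBall (hρ.trans hS.δ_le_R)
  refine Convex.norm_image_sub_le_of_norm_hasFDerivWithin_le'
    (f := Ψ t) (f' := Ψy t) (φ := A) (s := closedBall (0 : E) ρ) (C := C * (t + ρ))
    (fun x hx => (hS.hasFDeriv_Ψ t ht x (mem_closedBall_zero_iff.1 (hsub hx))).mono hsub)
    (fun x hx => ?_) (convex_closedBall 0 ρ) (mem_closedBall_zero_iff.2 hy')
    (mem_closedBall_zero_iff.2 hy)
  have hx' : ‖x‖ ≤ ρ := mem_closedBall_zero_iff.1 hx
  have hC := hS.C_nonneg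
  calc ‖Ψy t x - A‖ ≤ C * (t + ‖x‖) := hS.Ψy_sub_A t ht x (hx'.trans hρ)
    _ ≤ C * (t + ρ) := by gcongr

/-- Uniform fibre contraction of `Ψ t` on the basin ball. -/
private theorem psi_contr (hS : SmoothHalfChart E φ Ψ A φg φy Ψg Ψy b C δ R θ') {t : ℝ}
    (ht : t ∈ Icc (0 : ℝ) δ) {y y' : E} (hy : ‖y‖ ≤ R) (hy' : ‖y'‖ ≤ R) :
    ‖Ψ t y - Ψ t y'‖ ≤ θ' * ‖y - y'‖ :=
  Convex.norm_image_sub_le_of_norm_hasFDerivWithin_le (f := Ψ t) (f' := Ψy t)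
    (s := closedBall (0 : E) R)
    (fun x hx => hS.hasFDeriv_Ψ t ht x (mem_closedBall_zero_iff.1 hx))
    (fun x hx => hS.Ψy_bound t ht x (mem_closedBall_zero_iff.1 hx))
    (convex_closedBall 0 R) (mem_closedBall_zero_iff.2 hy') (mem_closedBall_zero_iff.2 hy)

/-- Parabolic remainder of `Ψ` at the fixed point: `‖Ψ t y − A y‖ ≤ C (t² + t‖y‖ + ‖y‖²)`,
integrated from `Ψ 0 0 = 0` along `[0, t]` and along the segment `[0, y]`. -/
private theorem psi_rem (hS : SmoothHalfChart E φ Ψ A φg φy Ψg Ψy b C δ R θ') {t : ℝ}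
    (ht : t ∈ Icc (0 : ℝ) δ) {y : E} (hy : ‖y‖ ≤ δ) :
    ‖Ψ t y - A y‖ ≤ C * (t ^ 2 + t * ‖y‖ + ‖y‖ ^ 2) := by
  have h0 : (0 : ℝ) ∈ Icc (0 : ℝ) δ := ⟨le_rfl, hS.δ_pos.le⟩
  have h1 := psi_base hS h0 ht hy
  have h2 := psi_fibre hS h0 hy le_rfl (by simp : ‖(0 : E)‖ ≤ ‖y‖)
  simp only [max_eq_left ht.1, sub_zero, abs_of_nonneg ht.1] at h1
  simp only [hS.Ψ_zero_zero, sub_zero, zero_add] at h2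
  calc ‖Ψ t y - A y‖ = ‖(Ψ t y - Ψ 0 y) + (Ψ 0 y - A y)‖ := by rw [sub_add_sub_cancel]
    _ ≤ ‖Ψ t y - Ψ 0 y‖ + ‖Ψ 0 y - A y‖ := norm_add_le _ _
    _ ≤ C * (t + ‖y‖) * t + C * ‖y‖ * ‖y‖ := add_le_add h1 h2
    _ = C * (t ^ 2 + t * ‖y‖ + ‖y‖ ^ 2) := by ring

end HalfChart

section Extension

/-- Odd extension across `g = 0` of a two-point parabolic Lipschitz bound on `[0, δ]`:
same signs by the half-line bound, opposite signs by `|H u + H v| ≤ |H u| + |H v|` and the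
one-point bounds integrated from `H 0 = 0`. -/
private theorem odd_ext {H He : ℝ → ℝ} {K a δ : ℝ} (hK : 0 ≤ K) (ha : 0 ≤ a) (h0 : H 0 = 0)
    (hH : ∀ s ∈ Icc (0 : ℝ) δ, ∀ t ∈ Icc (0 : ℝ) δ,
      |H t - H s| ≤ K * (max t s) ^ 2 * (max t s + a) * |t - s|)
    (hpos : ∀ g : ℝ, 0 ≤ g → He g = H g) (hneg : ∀ g : ℝ, g < 0 → He g = -H (-g))
    {g g' : ℝ} (hg : |g| ≤ δ) (hg' : |g'| ≤ δ) :
    |He g - He g'| ≤ K * (max |g| |g'|) ^ 2 * (max |g| |g'| + a) * |g - g'| := by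
  have hδ : 0 ≤ δ := (abs_nonneg g).trans hg
  have h1 : ∀ u ∈ Icc (0 : ℝ) δ, ∀ m : ℝ, u ≤ m → |H u| ≤ K * m ^ 2 * (m + a) * u := by
    intro u hu m hum
    have hu0 : 0 ≤ u := hu.1
    have h := hH 0 ⟨le_rfl, hδ⟩ u hu
    simp only [h0, sub_zero, max_eq_left hu0, abs_of_nonneg hu0] at h
    calc |H u| ≤ K * u ^ 2 * (u + a) * u := h
      _ ≤ K * m ^ 2 * (m + a) * u := by gcongr
  have h2 : ∀ u ∈ Icc (0 : ℝ) δ, ∀ v ∈ Icc (0 : ℝ) δ,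
      |H u + H v| ≤ K * (max u v) ^ 2 * (max u v + a) * (u + v) := by
    intro u hu v hv
    calc |H u + H v| ≤ |H u| + |H v| := abs_add_le _ _
      _ ≤ K * (max u v) ^ 2 * (max u v + a) * u + K * (max u v) ^ 2 * (max u v + a) * v :=
          add_le_add (h1 u hu _ (le_max_left u v)) (h1 v hv _ (le_max_right u v))
      _ = K * (max u v) ^ 2 * (max u v + a) * (u + v) := by ring
  rcases le_or_gt 0 g with hg0 | hg0 <;> rcases le_or_gt 0 g' with hg0' | hg0'
  · have hgI : g ∈ Icc (0 : ℝ) δ := ⟨hg0, (le_abs_self g).trans hg⟩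
    have hgI' : g' ∈ Icc (0 : ℝ) δ := ⟨hg0', (le_abs_self g').trans hg'⟩
    rw [hpos g hg0, hpos g' hg0', abs_of_nonneg hg0, abs_of_nonneg hg0']
    exact hH g' hgI' g hgI
  · have hgI : g ∈ Icc (0 : ℝ) δ := ⟨hg0, (le_abs_self g).trans hg⟩
    have hgI' : -g' ∈ Icc (0 : ℝ) δ := ⟨by linarith, (neg_le_abs g').trans hg'⟩
    calc |He g - He g'| = |H g + H (-g')| := by rw [hpos g hg0, hneg g' hg0', sub_neg_eq_add]
      _ ≤ K * (max g (-g')) ^ 2 * (max g (-g') + a) * (g + -g') := h2 g hgI (-g') hgI'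
      _ = K * (max |g| |g'|) ^ 2 * (max |g| |g'| + a) * |g - g'| := by
          rw [abs_of_nonneg hg0, abs_of_neg hg0', abs_of_nonneg (by linarith : 0 ≤ g - g')]
          ring
  · have hgI : -g ∈ Icc (0 : ℝ) δ := ⟨by linarith, (neg_le_abs g).trans hg⟩
    have hgI' : g' ∈ Icc (0 : ℝ) δ := ⟨hg0', (le_abs_self g').trans hg'⟩
    calc |He g - He g'| = |H (-g) + H g'| := by
          rw [hneg g hg0, hpos g' hg0', ← abs_neg]
          congr 1
          ring
      _ ≤ K * (max (-g) g') ^ 2 * (max (-g) g' + a) * (-g + g') := h2 (-g) hgI g' hgI'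
      _ = K * (max |g| |g'|) ^ 2 * (max |g| |g'| + a) * |g - g'| := by
          rw [abs_of_neg hg0, abs_of_nonneg hg0', abs_of_nonpos (by linarith : g - g' ≤ 0)]
          ring
  · have hgI : -g ∈ Icc (0 : ℝ) δ := ⟨by linarith, (neg_le_abs g).trans hg⟩
    have hgI' : -g' ∈ Icc (0 : ℝ) δ := ⟨by linarith, (neg_le_abs g').trans hg'⟩
    calc |He g - He g'| = |H (-g) - H (-g')| := by
          rw [hneg g hg0, hneg g' hg0', ← abs_neg]
          congr 1
          ring
      _ ≤ K * (max (-g) (-g')) ^ 2 * (max (-g) (-g') + a) * |-g - -g'| := hH (-g') hgI' (-g) hgI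
      _ = K * (max |g| |g'|) ^ 2 * (max |g| |g'| + a) * |g - g'| := by
          rw [abs_of_neg hg0, abs_of_neg hg0', show -g - -g' = g' - g by ring, abs_sub_comm g' g]

variable {E : Type} [NormedAddCommGroup E]

/-- Even extension across `g = 0` of a two-point Lipschitz bound on `[0, δ]`
(`| |g| − |g'| | ≤ |g − g'|`, `max |g| |g'| ≤ |g| + |g'|`). -/
private theorem even_ext {P : ℝ → E} {K a δ : ℝ} (hK : 0 ≤ K) (ha : 0 ≤ a)
    (hP : ∀ s ∈ Icc (0 : ℝ) δ, ∀ t ∈ Icc (0 : ℝ) δ, ‖P t - P s‖ ≤ K * (max t s + a) * |t - s|)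
    {g g' : ℝ} (hg : |g| ≤ δ) (hg' : |g'| ≤ δ) :
    ‖P |g| - P |g'|‖ ≤ K * (|g| + |g'| + a) * |g - g'| := by
  have hm : max |g| |g'| ≤ |g| + |g'| := max_le_add_of_nonneg (abs_nonneg g) (abs_nonneg g')
  have hd : |(|g| - |g'|)| ≤ |g - g'| := abs_abs_sub_abs_le_abs_sub g g'
  calc ‖P |g| - P |g'|‖ ≤ K * (max |g| |g'| + a) * |(|g| - |g'|)| :=
        hP |g'| ⟨abs_nonneg _, hg'⟩ |g| ⟨abs_nonneg _, hg⟩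
    _ ≤ K * (|g| + |g'| + a) * |g - g'| := by gcongr

end Extension

section Assembly

variable {E : Type} [NormedAddCommGroup E] [NormedSpace ℝ E]
  {φ : ℝ → E → ℝ} {Ψ : ℝ → E → E} {A : E →L[ℝ] E}
  {φg : ℝ → E → ℝ} {φy : ℝ → E → (E →L[ℝ] ℝ)} {Ψg : ℝ → E → E} {Ψy : ℝ → E → (E →L[ℝ] E)}
  {b C δ R θ' : ℝ}

/-- Assembly: any pair `(φ', Ψ')` that is the odd/even extension of a smooth half-chart satisfies
the two-sided parabolic block and the basin clauses with the constant `2C + 1`. -/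
private theorem blocks_of_ext (hS : SmoothHalfChart E φ Ψ A φg φy Ψg Ψy b C δ R θ')
    {φ' : ℝ → E → ℝ} {Ψ' : ℝ → E → E}
    (hφp : ∀ g : ℝ, 0 ≤ g → ∀ y : E, φ' g y = φ g y)
    (hφn : ∀ g : ℝ, g < 0 → ∀ y : E, φ' g y = -φ (-g) y)
    (hΨ : ∀ (g : ℝ) (y : E), Ψ' g y = Ψ |g| y) :
    ParabolicBlock E φ' Ψ' A b (2 * C + 1) δ ∧ BasinBlock E φ' Ψ' b (2 * C + 1) δ R θ' := by
  have hC := hS.C_nonneg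
  have hCC : C ≤ 2 * C + 1 := by linarith
  have hδR := hS.δ_le_R
  have habs : ∀ {g : ℝ}, |g| ≤ δ → |g| ∈ Icc (0 : ℝ) δ := fun hg => ⟨abs_nonneg _, hg⟩
  -- φ: two-point bound for the odd extension of `h(t) = φ t y − (t + b t³)`
  have hφ2 : ∀ {g g' : ℝ} {y : E}, |g| ≤ δ → |g'| ≤ δ → ‖y‖ ≤ R →
      |φ' g y - (g + b * g ^ 3) - (φ' g' y - (g' + b * g' ^ 3))| ≤
        C * (max |g| |g'|) ^ 2 * (max |g| |g'| + ‖y‖) * |g - g'| := by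
    intro g g' y hg hg' hy
    refine odd_ext (H := fun t => φ t y - (t + b * t ^ 3)) (He := fun g => φ' g y - (g + b * g ^ 3))
      hC (norm_nonneg y) ?_ (fun s hs t ht => phi_base hS hs ht hy) ?_ ?_ hg hg'
    · simp [hS.φ_zero y hy]
    · intro g hg
      simp [hφp g hg]
    · intro g hg
      simp only [hφn g hg]
      ring
  -- φ: one-point bound (remainder), on the basin ball
  have hφ1 : ∀ {g : ℝ} {y : E}, |g| ≤ δ → ‖y‖ ≤ R →
      |φ' g y - (g + b * g ^ 3)| ≤ (2 * C + 1) * (g ^ 4 + |g| ^ 3 * ‖y‖) := by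
    intro g y hg hy
    have h0 : |(0 : ℝ)| ≤ δ := by rw [abs_zero]; exact (abs_nonneg g).trans hg
    have h := hφ2 hg h0 hy
    have e1 : φ' 0 y - (0 + b * 0 ^ 3) = 0 := by rw [hφp 0 le_rfl, hS.φ_zero y hy]; ring
    have e2 : max |g| |0| = |g| := by rw [abs_zero]; exact max_eq_left (abs_nonneg g)
    rw [e1, e2, sub_zero, sub_zero] at h
    have e3 : |g| ^ 2 = g ^ 2 := sq_abs g
    calc |φ' g y - (g + b * g ^ 3)| ≤ C * |g| ^ 2 * (|g| + ‖y‖) * |g| := h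
      _ = C * (g ^ 4 + |g| ^ 3 * ‖y‖) := by linear_combination C * (|g| ^ 2 + g ^ 2) * e3
      _ ≤ (2 * C + 1) * (g ^ 4 + |g| ^ 3 * ‖y‖) := by gcongr
  refine ⟨⟨?_, ?_, ?_⟩, ?_, ?_⟩
  · -- remainder
    intro g y hg hy
    refine ⟨hφ1 hg (hy.trans hδR), ?_⟩
    rw [hΨ]
    have h1 : |g| * ‖y‖ ≤ g ^ 2 + ‖y‖ ^ 2 := by
      nlinarith [sq_nonneg (|g| - ‖y‖), sq_abs g, abs_nonneg g, norm_nonneg y]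
    have h2 := mul_le_mul_of_nonneg_left h1 hC
    calc ‖Ψ |g| y - A y‖ ≤ C * (|g| ^ 2 + |g| * ‖y‖ + ‖y‖ ^ 2) := psi_rem hS (habs hg) hy
      _ ≤ (2 * C + 1) * (g ^ 2 + ‖y‖ ^ 2) := by
          rw [sq_abs]
          nlinarith [h2, sq_nonneg g, sq_nonneg ‖y‖]
  · -- lipschitz_fibre
    intro g y y' hg hy hy'
    refine ⟨?_, ?_⟩
    · have e : |φ' g y - φ' g y'| = |φ |g| y - φ |g| y'| := by
        rcases le_or_gt 0 g with h0 | h0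
        · rw [hφp g h0, hφp g h0, abs_of_nonneg h0]
        · rw [hφn g h0, hφn g h0, abs_of_neg h0, ← abs_neg]
          congr 1
          ring
      rw [e]
      calc |φ |g| y - φ |g| y'| ≤ C * |g| ^ 3 * ‖y - y'‖ := phi_fibre hS (habs hg) hy hy'
        _ ≤ (2 * C + 1) * |g| ^ 3 * ‖y - y'‖ := by gcongr
    · rw [hΨ, hΨ]
      have hm : max ‖y‖ ‖y'‖ ≤ ‖y‖ + ‖y'‖ := max_le_add_of_nonneg (norm_nonneg _) (norm_nonneg _)
      calc ‖Ψ |g| y - Ψ |g| y' - A (y - y')‖ ≤ C * (|g| + max ‖y‖ ‖y'‖) * ‖y - y'‖ :=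
            psi_fibre hS (habs hg) (max_le hy hy') (le_max_left _ _) (le_max_right _ _)
        _ ≤ (2 * C + 1) * (|g| + ‖y‖ + ‖y'‖) * ‖y - y'‖ := by
            apply mul_le_mul_of_nonneg_right _ (norm_nonneg _)
            nlinarith [abs_nonneg g, norm_nonneg y, norm_nonneg y', hm, hC]
  · -- lipschitz_base
    intro g g' y hg hg' hy
    refine ⟨?_, ?_⟩
    · calc |φ' g y - φ' g' y - (g - g') - b * (g ^ 3 - g' ^ 3)|
            = |φ' g y - (g + b * g ^ 3) - (φ' g' y - (g' + b * g' ^ 3))| := by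
              congr 1
              ring
        _ ≤ C * (max |g| |g'|) ^ 2 * (max |g| |g'| + ‖y‖) * |g - g'| := hφ2 hg hg' (hy.trans hδR)
        _ ≤ (2 * C + 1) * (max |g| |g'|) ^ 2 * (max |g| |g'| + ‖y‖) * |g - g'| := by gcongr
    · rw [hΨ, hΨ]
      calc ‖Ψ |g| y - Ψ |g'| y‖ ≤ C * (|g| + |g'| + ‖y‖) * |g - g'| :=
            even_ext (P := fun t => Ψ t y) hC (norm_nonneg y)
              (fun s hs t ht => psi_base hS hs ht hy) hg hg'
        _ ≤ (2 * C + 1) * (|g| + |g'| + ‖y‖) * |g - g'| := by gcongr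
  · -- contraction
    intro g y y' hg hy hy'
    rw [hΨ, hΨ]
    exact psi_contr hS (habs hg) hy hy'
  · -- remainder_basin
    intro g y hg hy
    exact hφ1 hg hy

end Assembly

/-- **Stub `stub_parabolicBlock` of the line `perfect-action-regulator-chart` (crux
`BalabanStepParabolic`, route `ParabolicTrajectory`).** A smooth half-chart normal form
`SmoothHalfChart E φ Ψ A φg φy Ψg Ψy b C δ R θ'` (partial derivatives within `[0, δ]` in the
coupling and within closed balls in the fibre, parabolic derivative bounds, `φ 0 y = 0`,
`Ψ 0 0 = 0`) yields maps `(φ', Ψ')` agreeing with `(φ, Ψ)` on `g ≥ 0` — the odd/even extension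
`φ' g y = −φ (−g) y`, `Ψ' g y = Ψ |g| y` for `g < 0` — together with a constant `C' > 0`
(`C' = 2C + 1`) such that the verbatim Lipschitz hypothesis block `ParabolicBlock E φ' Ψ' A b C' δ`
(remainder, fibre and base Lipschitz bounds on `|g| ≤ δ`, `‖y‖ ≤ δ`) and the basin clauses
`BasinBlock E φ' Ψ' b C' δ R θ'` (fibre contraction and remainder on `‖y‖ ≤ R`) hold. Proof:
one-variable mean value inequalities along sub-intervals of `[0, δ]` and along segments in convex
balls, integrated from the normalisations; negative couplings by the odd/even symmetry. [folklore] -/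
theorem stub_parabolicBlock :
    ∀ (E : Type) [NormedAddCommGroup E] [NormedSpace ℝ E]
      (φ : ℝ → E → ℝ) (Ψ : ℝ → E → E) (A : E →L[ℝ] E)
      (φg : ℝ → E → ℝ) (φy : ℝ → E → (E →L[ℝ] ℝ)) (Ψg : ℝ → E → E) (Ψy : ℝ → E → (E →L[ℝ] E))
      (b C δ R θ' : ℝ),
      SmoothHalfChart E φ Ψ A φg φy Ψg Ψy b C δ R θ' →
      ∃ (φ' : ℝ → E → ℝ) (Ψ' : ℝ → E → E) (C' : ℝ), 0 < C' ∧
        (∀ g : ℝ, 0 ≤ g → ∀ y : E, φ' g y = φ g y ∧ Ψ' g y = Ψ g y) ∧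
        ParabolicBlock E φ' Ψ' A b C' δ ∧ BasinBlock E φ' Ψ' b C' δ R θ' := by
  intro E _ _ φ Ψ A φg φy Ψg Ψy b C δ R θ' hS
  refine ⟨fun g y => if 0 ≤ g then φ g y else -φ (-g) y, fun g y => Ψ |g| y, 2 * C + 1,
    by linarith [hS.C_nonneg], fun g hg y => ⟨if_pos hg, by simp only [abs_of_nonneg hg]⟩, ?_⟩
  exact blocks_of_ext hS (fun g hg y => if_pos hg) (fun g hg y => if_neg (not_le.mpr hg))
    fun g y => rfl

end Summit.QuantumFields.YangMills.Theorems.BalabanStepParabolic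

end
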